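import Summits.Ventures.DiscreteObjects.PP12.OrderElevenTriangleDecomp

/-!
# PP(12), order-11 cell, Case B (triangle): the pencil conditions (Φ) and (K) of `TriangleData.Valid` for the plane's data (kernel; proofs)
Framing: lottery ticket; floor = certified bounds/negative ranges.

Cell pub-namedobj (venture DiscreteObjects), target (M), designs gen 16. Setting and notation of `OrderElevenTriangleFrame`; `D = triData11`.
* exponent bookkeeping in `Fin 11` (`pow_fin_add_apply`, `pow_fin_sub_apply_mem_iff`, `pow_fin_mem_pow_sub`);
* **`partition_generic`**: for a vertex pencil (`v ∈ M`, base side point `Q ∈ M`, the other points of `M` free, `M` moved by all powers) and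
  offsets `f t` with `σ^{f t} P_t ∈ M`, a vertex-free line `B_s` meeting the orbit of `Q` in position `g` satisfies
  `TriangleData.PartitionOK D s f g` — the three instances are the conditions (K) for the pencils of `v0` (`f = 0`, `g = 0`), `v1` (`f = id`,
  `g = g1 s`) and `v2` (`f = phi`, `g = g2 s`) (`partitionOK0/1/2`);
* **`phiOK11 : D.PhiOK`** (Φ): `phi` and `t ↦ t − phi t` are injective (two free base points with the same third-pencil position, resp. the
  same `M_1`/`M_2` offset, would lie on two distinct lines through their common point).
Proofs only; nothing asserts any census statement. No `sorry`, no new axioms.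
-/

namespace Summit.Ventures.DiscreteObjects.PP12

open Configuration Finset
open scoped Classical

namespace Collineation

variable {P L : Type*} [Membership P L] (σ : Collineation P L) [ProjectivePlane P L] [Fintype P] [Fintype L]

section ElevenB

variable (h12 : ProjectivePlane.order P L = 12) (hq : σ.onPoints ^ 11 = 1)
  (hB : ∀ l : L, σ.onLines l = l → ∀ [DecidablePred (· ∈ l)], σ.fixedOnLine l = 2)

/-! ### Exponent bookkeeping in `Fin 11` -/

omit [ProjectivePlane P L] [Fintype P] [Fintype L] in
include hq in
/-- `σ^{y + a} p = σ^y (σ^a p)` for `y, a ∈ Fin 11` -/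
theorem pow_fin_add_apply (y a : Fin 11) (p : P) :
    (σ.onPoints ^ ((y + a : Fin 11) : ℕ)) p = (σ.onPoints ^ (y : ℕ)) ((σ.onPoints ^ (a : ℕ)) p) := by
  rw [← Equiv.Perm.mul_apply, ← pow_add, pow_apply_eq_pow_mod σ.onPoints hq ((y : ℕ) + (a : ℕ)), Fin.val_add]

omit [ProjectivePlane P L] [Fintype P] [Fintype L] in
include hq in
/-- `σ^{x − δ} p ∈ m ↔ σ^x p ∈ σ^δ m` for `x, δ ∈ Fin 11` -/
theorem pow_fin_sub_apply_mem_iff (x δ : Fin 11) (p : P) (m : L) :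
    (σ.onPoints ^ ((x - δ : Fin 11) : ℕ)) p ∈ m ↔ (σ.onPoints ^ (x : ℕ)) p ∈ (σ.onLines ^ (δ : ℕ)) m := by
  rw [← σ.pow_mem_iff (δ : ℕ) ((σ.onPoints ^ ((x - δ : Fin 11) : ℕ)) p) m, ← σ.pow_fin_add_apply hq, add_sub_cancel]

omit [ProjectivePlane P L] [Fintype P] [Fintype L] in
include hq in
/-- from `σ^a p ∈ m`: `σ^b p ∈ σ^{b − a} m` (`a, b ∈ Fin 11`) -/
theorem pow_fin_mem_pow_sub {a b : Fin 11} {p : P} {m : L} (h : (σ.onPoints ^ (a : ℕ)) p ∈ m) :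
    (σ.onPoints ^ (b : ℕ)) p ∈ (σ.onLines ^ ((b - a : Fin 11) : ℕ)) m := by
  have e2 : (σ.onPoints ^ (b : ℕ)) p = (σ.onPoints ^ ((b - a : Fin 11) : ℕ)) ((σ.onPoints ^ (a : ℕ)) p) := by
    rw [← σ.pow_fin_add_apply hq, sub_add_cancel]
  rw [e2]; exact (σ.pow_mem_iff _ _ _).2 h

/-! ### The generic pencil partition -/

/-- **Generic (K).** See the file header. -/
theorem partition_generic {v Q : P} {M : L} (fv : σ.onPoints v = v) (hvM : v ∈ M) (hQM : Q ∈ M)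
    (hfree : ∀ p : P, p ∈ M → p ≠ v → p ≠ Q → p ∈ σ.freePts h12 hq hB) (hmov : ∀ k : ℕ, ¬ 11 ∣ k → (σ.onLines ^ k) M ≠ M)
    (hvnf : v ∉ σ.freePts h12 hq hB) (hQnf : ∀ k : ℕ, (σ.onPoints ^ k) Q ∉ σ.freePts h12 hq hB)
    (f : Fin 11 → Fin 11) (hf : ∀ t, (σ.onPoints ^ ((f t : Fin 11) : ℕ)) (σ.fp11 h12 hq hB t) ∈ M)
    (s : Fin 11) (hvs : v ∉ σ.fb11 h12 hq hB s) (g : Fin 11) (hg : (σ.onPoints ^ (g : ℕ)) Q ∈ σ.fb11 h12 hq hB s)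
    (hg' : ∀ y : Fin 11, (σ.onPoints ^ (y : ℕ)) Q ∈ σ.fb11 h12 hq hB s → y = g) :
    (σ.triData11 h12 hq hB).PartitionOK s f g := by
  -- the pencil line `σ^y M` and the free line `B_s`
  have hvy : ∀ y : ℕ, v ∈ (σ.onLines ^ y) M := fun y => (σ.tv_mem_pow_iff fv y M).2 hvM
  have hne : ∀ y : ℕ, (σ.onLines ^ y) M ≠ σ.fb11 h12 hq hB s := fun y e => hvs (e ▸ hvy y)
  have hmemM : ∀ (y : Fin 11) (t : Fin 11), (σ.onPoints ^ ((y + f t : Fin 11) : ℕ)) (σ.fp11 h12 hq hB t) ∈ (σ.onLines ^ (y : ℕ)) M :=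
    fun y t => by rw [σ.pow_fin_add_apply hq]; exact (σ.pow_mem_iff _ _ _).2 (hf t)
  refine ⟨fun t => ?_, fun y hy => ?_⟩
  · -- (i) the line of position `g` carries no free point of `B_s`
    rw [Bool.eq_false_iff, Ne, triData11_mem]
    intro hmem
    have hQ1 : (σ.onPoints ^ (g : ℕ)) Q ∈ (σ.onLines ^ (g : ℕ)) M := (σ.pow_mem_iff _ _ _).2 hQM
    have e := (Nondegenerate.eq_or_eq hmem hg (hmemM g t) hQ1).resolve_right (hne g).symm
    exact hQnf g (e ▸ σ.pow_fp11_free h12 hq hB _ t)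
  · -- (ii) every other line meets `B_s` in exactly one free point
    set R : P := HasPoints.mkPoint (hne y) with hRdef
    have hR1 : R ∈ (σ.onLines ^ (y : ℕ)) M := (HasPoints.mkPoint_ax (hne y)).1
    have hR2 : R ∈ σ.fb11 h12 hq hB s := (HasPoints.mkPoint_ax (hne y)).2
    set p := (σ.onPoints ^ (y : ℕ)).symm R with hp
    have hpR : (σ.onPoints ^ (y : ℕ)) p = R := (σ.onPoints ^ (y : ℕ)).apply_symm_apply R
    have hpM : p ∈ M := by rw [← σ.pow_mem_iff (y : ℕ), hpR]; exact hR1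
    have hpv : p ≠ v := by
      intro e; apply hvs; rw [← Equiv.Perm.pow_apply_eq_self_of_apply_eq_self fv (y : ℕ), ← e, hpR]; exact hR2
    have hpQ : p ≠ Q := by
      intro e; apply hy; apply hg'; rw [← e, hpR]; exact hR2
    have hpF := hfree p hpM hpv hpQ
    obtain ⟨u, x, hux⟩ := σ.free_decomp h12 hq hB hpF
    -- the offset of `P_u` on `M` is `f u`
    have hxM : (σ.onPoints ^ (x : ℕ)) (σ.fp11 h12 hq hB u) ∈ M := by rw [hux]; exact hpM
    have hxf : x = f u := by
      have e := σ.orbit_meets_once11 hq fv hvM hmov (p := σ.fp11 h12 hq hB u)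
        (fun k e => hvnf (e ▸ σ.pow_fp11_free h12 hq hB k u)) hxM (hf u)
      rw [Nat.mod_eq_of_lt x.isLt, Nat.mod_eq_of_lt (f u).isLt] at e
      exact Fin.ext e
    have hRu : (σ.onPoints ^ ((y + f u : Fin 11) : ℕ)) (σ.fp11 h12 hq hB u) = R := by
      rw [σ.pow_fin_add_apply hq, ← hxf, hux, hpR]
    refine ⟨u, (σ.triData11_mem h12 hq hB s u _).2 (hRu ▸ hR2), fun t' ht' => ?_⟩
    rw [triData11_mem] at ht'
    have e : (σ.onPoints ^ ((y + f t' : Fin 11) : ℕ)) (σ.fp11 h12 hq hB t') = R :=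
      (Nondegenerate.eq_or_eq (hmemM y t') hR1 ht' hR2).resolve_right (hne y)
    exact (σ.free_decomp_unique h12 hq hB (e.trans hRu.symm)).1

/-! ### The three instances -/

/-- positions on `S_0`: `σ^y Q_0 ∈ B_s` only for `y = 0` -/
theorem pos0_unique (s : Fin 11) (y : Fin 11) (h : (σ.onPoints ^ (y : ℕ)) (σ.sq0 h12 hq hB) ∈ σ.fb11 h12 hq hB s) : y = 0 := by
  have e := σ.eq_sq0_of_mem_fb11_sd0 h12 hq hB s h (σ.pow_sq_mem h12 hq hB _).1
  by_contra hy
  have hy' : ¬ 11 ∣ (y : ℕ) := fun hd => hy (Fin.ext (by have := y.isLt; simp only [Fin.val_zero]; omega))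
  exact (σ.pow_sq_ne h12 hq hB hy').1 e

/-- positions on `S_1`: `σ^y Q_1 ∈ B_s` only for `y = g1 s` -/
theorem pos1_unique (s : Fin 11) (y : Fin 11) (h : (σ.onPoints ^ (y : ℕ)) (σ.sq1 h12 hq hB) ∈ σ.fb11 h12 hq hB s) :
    y = (σ.triData11 h12 hq hB).g1 s := by
  have G := σ.g1N11_spec h12 hq hB s
  have e := (Nondegenerate.eq_or_eq h G.2 (σ.pow_sq_mem h12 hq hB _).2.1 (σ.pow_sq_mem h12 hq hB _).2.1).resolve_right
    (σ.fb11_ne_sd h12 hq hB s).2.1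
  have m := pow_apply_mod_inj σ.onPoints hq (fun k hk => (σ.pow_sq_ne h12 hq hB hk).2.1) e
  rw [triData11_g1]
  apply Fin.ext
  rw [fin11_val_of_lt G.1, ← Nat.mod_eq_of_lt y.isLt, m, Nat.mod_eq_of_lt G.1]

/-- positions on `S_2`: `σ^y Q_2 ∈ B_s` only for `y = g2 s` -/
theorem pos2_unique (s : Fin 11) (y : Fin 11) (h : (σ.onPoints ^ (y : ℕ)) (σ.sq2 h12 hq hB) ∈ σ.fb11 h12 hq hB s) :
    y = (σ.triData11 h12 hq hB).g2 s := by
  have G := σ.g2N11_spec h12 hq hB s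
  have e := (Nondegenerate.eq_or_eq h G.2 (σ.pow_sq_mem h12 hq hB _).2.2 (σ.pow_sq_mem h12 hq hB _).2.2).resolve_right
    (σ.fb11_ne_sd h12 hq hB s).2.2
  have m := pow_apply_mod_inj σ.onPoints hq (fun k hk => (σ.pow_sq_ne h12 hq hB hk).2.2) e
  rw [triData11_g2]
  apply Fin.ext
  rw [fin11_val_of_lt G.1, ← Nat.mod_eq_of_lt y.isLt, m, Nat.mod_eq_of_lt G.1]

/-- `σ^{g1 s} Q_1 ∈ B_s` (with the `Fin 11` exponent) -/
theorem pow_g1_sq1_mem (s : Fin 11) : (σ.onPoints ^ (((σ.triData11 h12 hq hB).g1 s : Fin 11) : ℕ)) (σ.sq1 h12 hq hB) ∈ σ.fb11 h12 hq hB s := by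
  rw [triData11_g1, fin11_val_of_lt (σ.g1N11_spec h12 hq hB s).1]; exact (σ.g1N11_spec h12 hq hB s).2

/-- `σ^{g2 s} Q_2 ∈ B_s` (with the `Fin 11` exponent) -/
theorem pow_g2_sq2_mem (s : Fin 11) : (σ.onPoints ^ (((σ.triData11 h12 hq hB).g2 s : Fin 11) : ℕ)) (σ.sq2 h12 hq hB) ∈ σ.fb11 h12 hq hB s := by
  rw [triData11_g2, fin11_val_of_lt (σ.g2N11_spec h12 hq hB s).1]; exact (σ.g2N11_spec h12 hq hB s).2

/-- `σ^{phi t} P_t ∈ M_2` (with the `Fin 11` exponent) -/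
theorem pow_phi_fp11_mem (t : Fin 11) : (σ.onPoints ^ (((σ.triData11 h12 hq hB).phi t : Fin 11) : ℕ)) (σ.fp11 h12 hq hB t) ∈ σ.pm2 h12 hq hB := by
  rw [triData11_phi, fin11_val_of_lt (σ.phiN11_spec h12 hq hB t).1]; exact (σ.phiN11_spec h12 hq hB t).2

/-- vertices are not free -/
theorem tv_not_free : σ.tv0 h12 hq hB ∉ σ.freePts h12 hq hB ∧ σ.tv1 h12 hq hB ∉ σ.freePts h12 hq hB ∧ σ.tv2 h12 hq hB ∉ σ.freePts h12 hq hB :=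
  ⟨σ.not_free_of_mem_sd h12 hq hB (Or.inr (Or.inl (σ.tv_mem_sd h12 hq hB).2.2.1)),
    σ.not_free_of_mem_sd h12 hq hB (Or.inl (σ.tv_mem_sd h12 hq hB).1), σ.not_free_of_mem_sd h12 hq hB (Or.inl (σ.tv_mem_sd h12 hq hB).2.1)⟩

/-- **(K), pencil of `v0`** -/
theorem partitionOK0 (s : Fin 11) : (σ.triData11 h12 hq hB).PartitionOK s (fun _ => 0) 0 := by
  have F := σ.fb11_mem_freeLns h12 hq hB s
  rw [mem_freeLns] at F
  exact σ.partition_generic h12 hq hB (σ.tv_spec h12 hq hB).1 (σ.pm_mem h12 hq hB).1 (σ.pm_mem h12 hq hB).2.1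
    (fun p hp hv hQ => σ.free_of_mem_pm0 h12 hq hB hp hv hQ) (fun k hk => (σ.pow_pm_ne h12 hq hB hk).1) (σ.tv_not_free h12 hq hB).1
    (fun k => (σ.pow_sq_not_free h12 hq hB k).1) (fun _ => 0) (fun t => by simpa using σ.fp11_mem_pm0 h12 hq hB t) s F.1 0
    (by simpa using (σ.fb11_spec h12 hq hB s).1) (σ.pos0_unique h12 hq hB s)

/-- **(K), pencil of `v1`** -/
theorem partitionOK1 (s : Fin 11) : (σ.triData11 h12 hq hB).PartitionOK s id ((σ.triData11 h12 hq hB).g1 s) := by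
  have F := σ.fb11_mem_freeLns h12 hq hB s
  rw [mem_freeLns] at F
  exact σ.partition_generic h12 hq hB (σ.tv_spec h12 hq hB).2.1 (σ.pm_mem h12 hq hB).2.2.1 (σ.pm_mem h12 hq hB).2.2.2.1
    (fun p hp hv hQ => σ.free_of_mem_pm1 h12 hq hB hp hv hQ) (fun k hk => (σ.pow_pm_ne h12 hq hB hk).2.1) (σ.tv_not_free h12 hq hB).2.1
    (fun k => (σ.pow_sq_not_free h12 hq hB k).2.1) id (fun t => σ.pow_t_fp11_mem_pm1 h12 hq hB t) s F.2.1 _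
    (σ.pow_g1_sq1_mem h12 hq hB s) (σ.pos1_unique h12 hq hB s)

/-- **(K), pencil of `v2`** -/
theorem partitionOK2 (s : Fin 11) :
    (σ.triData11 h12 hq hB).PartitionOK s (σ.triData11 h12 hq hB).phi ((σ.triData11 h12 hq hB).g2 s) := by
  have F := σ.fb11_mem_freeLns h12 hq hB s
  rw [mem_freeLns] at F
  exact σ.partition_generic h12 hq hB (σ.tv_spec h12 hq hB).2.2.1 (σ.pm_mem h12 hq hB).2.2.2.2.1 (σ.pm_mem h12 hq hB).2.2.2.2.2
    (fun p hp hv hQ => σ.free_of_mem_pm2 h12 hq hB hp hv hQ) (fun k hk => (σ.pow_pm_ne h12 hq hB hk).2.2) (σ.tv_not_free h12 hq hB).2.2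
    (fun k => (σ.pow_sq_not_free h12 hq hB k).2.2) _ (fun t => σ.pow_phi_fp11_mem h12 hq hB t) s F.2.2 _
    (σ.pow_g2_sq2_mem h12 hq hB s) (σ.pos2_unique h12 hq hB s)

/-! ### (Φ) -/

/-- **(Φ) for the plane's data** -/
theorem phiOK11 : (σ.triData11 h12 hq hB).PhiOK := by
  have T := σ.tv_spec h12 hq hB
  -- M_2 is not a line of the pencils of v0, v1
  have hne0 : ∀ k : ℕ, σ.pm2 h12 hq hB ≠ (σ.onLines ^ k) (σ.pm0 h12 hq hB) := fun k e =>
    σ.tv0_not_mem_pm2 h12 hq hB (by rw [e]; exact (σ.tv_mem_pow_iff T.1 k _).2 (σ.pm_mem h12 hq hB).1)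
  have hne1 : ∀ k : ℕ, σ.pm2 h12 hq hB ≠ (σ.onLines ^ k) (σ.pm1 h12 hq hB) := fun k e =>
    σ.tv1_not_mem_pm2 h12 hq hB (by rw [e]; exact (σ.tv_mem_pow_iff T.2.1 k _).2 (σ.pm_mem h12 hq hB).2.2.1)
  refine ⟨fun t t' htt' => ?_, fun t t' htt' => ?_⟩
  · have h1 := σ.pow_phi_fp11_mem h12 hq hB t
    have h2 := σ.pow_phi_fp11_mem h12 hq hB t'
    rw [← htt'] at h2
    set φ := (σ.triData11 h12 hq hB).phi t
    have g1 : (σ.onPoints ^ (φ : ℕ)) (σ.fp11 h12 hq hB t) ∈ (σ.onLines ^ (φ : ℕ)) (σ.pm0 h12 hq hB) :=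
      (σ.pow_mem_iff _ _ _).2 (σ.fp11_mem_pm0 h12 hq hB t)
    have g2 : (σ.onPoints ^ (φ : ℕ)) (σ.fp11 h12 hq hB t') ∈ (σ.onLines ^ (φ : ℕ)) (σ.pm0 h12 hq hB) :=
      (σ.pow_mem_iff _ _ _).2 (σ.fp11_mem_pm0 h12 hq hB t')
    have e := (Nondegenerate.eq_or_eq h1 h2 g1 g2).resolve_right (hne0 _)
    exact (σ.free_decomp_unique h12 hq hB e).1
  · set φ := (σ.triData11 h12 hq hB).phi t
    set φ' := (σ.triData11 h12 hq hB).phi t'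
    have h1 := σ.pow_phi_fp11_mem h12 hq hB t
    have h2 := σ.pow_phi_fp11_mem h12 hq hB t'
    have g1 : (σ.onPoints ^ (φ : ℕ)) (σ.fp11 h12 hq hB t) ∈ (σ.onLines ^ ((φ - t : Fin 11) : ℕ)) (σ.pm1 h12 hq hB) :=
      σ.pow_fin_mem_pow_sub hq (σ.pow_t_fp11_mem_pm1 h12 hq hB t)
    have g2 : (σ.onPoints ^ (φ' : ℕ)) (σ.fp11 h12 hq hB t') ∈ (σ.onLines ^ ((φ' - t' : Fin 11) : ℕ)) (σ.pm1 h12 hq hB) :=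
      σ.pow_fin_mem_pow_sub hq (σ.pow_t_fp11_mem_pm1 h12 hq hB t')
    have hsub : φ' - t' = φ - t := by rw [← neg_sub t φ, ← neg_sub t' φ']; exact congrArg Neg.neg htt'.symm
    rw [hsub] at g2
    have e := (Nondegenerate.eq_or_eq h1 h2 g1 g2).resolve_right (hne1 _)
    exact (σ.free_decomp_unique h12 hq hB e).1

end ElevenB

end Collineation

end Summit.Ventures.DiscreteObjects.PP12
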